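import Summits.Schanuel.Schanuel.Theorems.ZilberEacBranchOneDirection
import Summits.Schanuel.Schanuel.Theorems.ZilberEacBranchPolarForm
import HarnessLib

/-!
# Arbitrary base branches, XXIII: the one-direction and no-direction theorems for branches in
# POLAR FORM `(U(s)s^{-k}, V(s)s^{-M})` — i.e. for raw Puiseux data at a place at infinity

HONEST FRAMING.  Cell `pub-schanuel` (Zilber's Exponential-Algebraic Closedness, case ladder;
host summit Schanuel), seat 2, gen 28.  A place at infinity of a plane curve presents itself as
`x₀ = U(s)s^{-k}`, `x₁ = V(s)s^{-M}` with `U, V` analytic, `U(0), V(0) ≠ 0` (Puiseux); file XI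
reparametrises `x₀` to the normal form `σ^{-k}` (`exists_polar_reparam`: `s = λ(σ) = σW(σ)`,
`W(0)^k = U(0)`).  Transporting file XIX along `λ`:
**`unprojectedDense_polarBranch_of_exists_direction`** — an irreducible closed `S ⊆ ℂ² × ℂ²` of
dimension `≤ 2` containing the cylinder germ `(U(s)s^{-k}, V(s)s^{-M}, ψ(s), e^{x₁})` (`k, M ≥ 1`,
`ψ(0) ≠ 0`) has Zariski-dense exponential points as soon as `Re(V(0)·y^M) ≠ 0` for SOME `y` with
`y^k·U(0) = 2πi` (the direction in the normal form is `V(0)W(0)^{-M}`, and `z = yW(0)` runs over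
the `k`-th roots of `2πi`); and **`unprojectedDense_polarBranch_of_not_dvd`** — if `k ∤ 2M` there is
NO direction condition.  Decided instances of an OPEN question (Mantova–Masser, PLMS 2024 §1 p. 5);
EC(3,2) OPEN; NOT Schanuel's conjecture (neither used nor implied); EAC ⇏ SC.
-/

noncomputable section

open Filter Topology Set Complex MvPolynomial
open Literature.NumberTheory.Transcendental Literature.ModelTheory.Zilber
open Literature.ModelTheory.ExponentialFields

set_option linter.dupNamespace false

namespace Summit.Schanuel.Schanuel.Theorems

/-- **One good direction, polar form.**  `S` irreducible closed of dimension `≤ 2` containing the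
cylinder germ `(U(s)s^{-k}, V(s)s^{-M}, ψ(s), e^{V(s)s^{-M}})` (`U(0), V(0), ψ(0) ≠ 0`, `k, M ≥ 1`)
with `Re(V(0)·y^M) ≠ 0` for some `y`, `y^k U(0) = 2πi`, has Zariski-dense exponential points.
[cite: MantovaMasser2023, §1 Further remarks, p. 5 (the question, open in general)] (new) -/
theorem unprojectedDense_polarBranch_of_exists_direction {S : Set (Fin 2 ⊕ Fin 2 → ℂ)}
    (hS : IsIrreducibleClosed ℂ S) (hdim : zariskiDim ℂ S ≤ (2 : ℕ))
    {k M : ℕ} (hk : 1 ≤ k) (hM : 1 ≤ M)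
    {ψ : ℂ → ℂ} (hψ : AnalyticAt ℂ ψ 0) {θ : ℂ} (hθ0 : θ ≠ 0) (hψ0 : ψ 0 = θ)
    {U : ℂ → ℂ} (hU : AnalyticAt ℂ U 0) (hU0 : U 0 ≠ 0)
    {V : ℂ → ℂ} (hV : AnalyticAt ℂ V 0)
    (hdir : ∃ y : ℂ, y ^ k * U 0 = 2 * Real.pi * I ∧ (V 0 * y ^ M).re ≠ 0)
    (hgerm : ∀ᶠ s in 𝓝[≠] (0 : ℂ),
      (Sum.elim ![U s * (s ^ k)⁻¹, V s * (s ^ M)⁻¹] ![ψ s, Complex.exp (V s * (s ^ M)⁻¹)] :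
        Fin 2 ⊕ Fin 2 → ℂ) ∈ S) :
    UnprojectedDense S := by
  obtain ⟨lam, W, hLan, hL0, hWan, hW0, hLW, hpolar⟩ := exists_polar_reparam hU hU0 hk
  -- the reparametrised data
  set ψt : ℂ → ℂ := fun σ => ψ (lam σ) with hψt
  set Φt : ℂ → ℂ := fun σ => V (lam σ) * (W σ ^ M)⁻¹ with hΦt
  have hψtan : AnalyticAt ℂ ψt 0 := hψ.comp_of_eq hLan hL0
  have hΦtan : AnalyticAt ℂ Φt 0 :=
    (hV.comp_of_eq hLan hL0).mul ((hWan.pow M).inv (pow_ne_zero _ hW0))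
  have hψt0 : ψt 0 = θ := by simp [hψt, hL0, hψ0]
  have hΦt0 : Φt 0 = V 0 * (W 0 ^ M)⁻¹ := by simp [hΦt, hL0]
  -- `lam` maps the punctured neighbourhood into itself
  have hLtend : Tendsto lam (𝓝[≠] (0 : ℂ)) (𝓝[≠] 0) := by
    refine tendsto_nhdsWithin_iff.2 ⟨?_, hpolar.mono fun σ h => h.1⟩
    have h := hLan.continuousAt.tendsto
    rw [hL0] at h
    exact h.mono_left nhdsWithin_le_nhds
  have hWne : ∀ᶠ σ in 𝓝 (0 : ℂ), W σ ≠ 0 := hWan.continuousAt.eventually_ne hW0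
  -- `W(0)^k = U(0)`: `U(λ(σ)) = W(σ)^k` for small `σ ≠ 0`, and both sides are continuous at `0`
  have hUW : ∀ᶠ σ in 𝓝[≠] (0 : ℂ), U (lam σ) = W σ ^ k := by
    filter_upwards [hpolar, nhdsWithin_le_nhds hWne, self_mem_nhdsWithin] with σ hp hWσ
      (hσ : σ ≠ 0)
    have h := hp.2
    have hl : lam σ ^ k = σ ^ k * W σ ^ k := by rw [hLW σ, mul_pow]
    rw [hl] at h
    have hσk : σ ^ k ≠ 0 := pow_ne_zero _ hσ
    have hWk : W σ ^ k ≠ 0 := pow_ne_zero _ hWσ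
    have e : U (lam σ) = (σ ^ k)⁻¹ * (σ ^ k * W σ ^ k) := by
      rw [← h, mul_assoc, inv_mul_cancel₀ (mul_ne_zero hσk hWk), mul_one]
    rw [e, ← mul_assoc, inv_mul_cancel₀ hσk, one_mul]
  have hW0k : W 0 ^ k = U 0 := by
    have h1 : Tendsto (fun σ => U (lam σ)) (𝓝[≠] (0 : ℂ)) (𝓝 (U 0)) := by
      have h := (hU.comp_of_eq hLan hL0).continuousAt.tendsto
      simp only [Function.comp, hL0] at h
      exact h.mono_left nhdsWithin_le_nhds
    have h2 : Tendsto (fun σ => W σ ^ k) (𝓝[≠] (0 : ℂ)) (𝓝 (W 0 ^ k)) :=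
      ((hWan.continuousAt.tendsto).pow k).mono_left nhdsWithin_le_nhds
    exact tendsto_nhds_unique (h2.congr' (hUW.mono fun σ h => h.symm)) h1
  -- the direction in the normal form
  have hdir' : ∃ z : ℂ, z ^ k = 2 * Real.pi * I ∧ (Φt 0 * z ^ M).re ≠ 0 := by
    obtain ⟨y, hy, hyre⟩ := hdir
    refine ⟨y * W 0, by rw [mul_pow, hW0k]; exact hy, ?_⟩
    have e : Φt 0 * (y * W 0) ^ M = V 0 * y ^ M := by
      rw [hΦt0, mul_pow]
      field_simp
    rw [e]
    exact hyre
  -- the coordinates along `s = lam σ`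
  have hcoord : ∀ᶠ σ in 𝓝[≠] (0 : ℂ),
      U (lam σ) * (lam σ ^ k)⁻¹ = (σ ^ k)⁻¹ ∧ V (lam σ) * (lam σ ^ M)⁻¹ = Φt σ * (σ ^ M)⁻¹ := by
    filter_upwards [hpolar, nhdsWithin_le_nhds hWne, self_mem_nhdsWithin] with σ hp hWσ hσ
    refine ⟨hp.2, ?_⟩
    have e : (lam σ ^ M)⁻¹ = (σ ^ M)⁻¹ * (W σ ^ M)⁻¹ := by rw [hLW σ, mul_pow, mul_inv]
    rw [e, hΦt]
    ring
  have hgerm' : ∀ᶠ σ in 𝓝[≠] (0 : ℂ),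
      (Sum.elim ![(σ ^ k)⁻¹, Φt σ * (σ ^ M)⁻¹] ![ψt σ, Complex.exp (Φt σ * (σ ^ M)⁻¹)] :
        Fin 2 ⊕ Fin 2 → ℂ) ∈ S := by
    filter_upwards [hLtend.eventually hgerm, hcoord] with σ hg hc
    rw [← hc.1, ← hc.2]
    exact hg
  exact unprojectedDense_branch_growth_of_exists_direction hS hdim hk hM hψtan hθ0 hψt0 hΦtan
    hdir' hgerm'

/-- **No direction condition when `k ∤ 2M`, polar form.**  `S` irreducible closed of dimension
`≤ 2` containing the cylinder germ `(U(s)s^{-k}, V(s)s^{-M}, ψ(s), e^{V(s)s^{-M}})` with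
`U(0), V(0), ψ(0) ≠ 0`, `k, M ≥ 1`, `k ∤ 2M` has Zariski-dense exponential points.
[cite: MantovaMasser2023, §1 Further remarks, p. 5 (the question, open in general)] (new) -/
theorem unprojectedDense_polarBranch_of_not_dvd {S : Set (Fin 2 ⊕ Fin 2 → ℂ)}
    (hS : IsIrreducibleClosed ℂ S) (hdim : zariskiDim ℂ S ≤ (2 : ℕ))
    {k M : ℕ} (hk : 1 ≤ k) (hM : 1 ≤ M) (hkM : ¬ k ∣ 2 * M)
    {ψ : ℂ → ℂ} (hψ : AnalyticAt ℂ ψ 0) {θ : ℂ} (hθ0 : θ ≠ 0) (hψ0 : ψ 0 = θ)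
    {U : ℂ → ℂ} (hU : AnalyticAt ℂ U 0) (hU0 : U 0 ≠ 0)
    {V : ℂ → ℂ} (hV : AnalyticAt ℂ V 0) (hV0 : V 0 ≠ 0)
    (hgerm : ∀ᶠ s in 𝓝[≠] (0 : ℂ),
      (Sum.elim ![U s * (s ^ k)⁻¹, V s * (s ^ M)⁻¹] ![ψ s, Complex.exp (V s * (s ^ M)⁻¹)] :
        Fin 2 ⊕ Fin 2 → ℂ) ∈ S) :
    UnprojectedDense S := by
  -- a `k`-th root `u` of `1/U(0)`; the directions `y = z·u`, `z^k = 2πi`, and file XIX's lemma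
  -- applied to `a = V(0)·u^M`
  obtain ⟨u, hu⟩ := IsAlgClosed.exists_pow_nat_eq (U 0)⁻¹ (by omega : 0 < k)
  have hu0 : u ≠ 0 := by
    rintro rfl
    rw [zero_pow (by omega)] at hu
    exact inv_ne_zero hU0 hu.symm
  obtain ⟨z, hz, hzre⟩ :=
    exists_direction_of_not_dvd hk hkM (mul_ne_zero hV0 (pow_ne_zero M hu0)) (M := M)
  refine unprojectedDense_polarBranch_of_exists_direction hS hdim hk hM hψ hθ0 hψ0 hU hU0 hV
    ⟨z * u, ?_, ?_⟩ hgerm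
  · rw [mul_pow, hu, hz, mul_assoc, inv_mul_cancel₀ hU0, mul_one]
  · have e : V 0 * (z * u) ^ M = V 0 * u ^ M * z ^ M := by ring
    rw [e]
    exact hzre

end Summit.Schanuel.Schanuel.Theorems

end
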